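import Literature.MathematicalPhysics.QuantumFieldTheory.Balaban1983to89.B4Thm110BoxCut
import Literature.MathematicalPhysics.QuantumFieldTheory.Balaban1983to89.B4Thm110BoxRegular

/-!
# `Balaban1983to89.B4Thm110BoxUniform` — [Balaban1983RegularityDecay] THEOREM p. 573, (1.10) value member, ON A BOX,
# HYPOTHESIS-FREE FOR A (1.7)-REGULAR FIELD CONSTANT NEAR `∂Ω`, WITH «e SUFFICIENTLY SMALL» UNIFORM IN `Ω`
# (the print's cut cubes; discharge of the per-cube inputs of `B4Thm110BoxCut` on the sub-boxes of sides `≤ 2K`)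

statement-level skeleton of published theorems with citation tags; proofs where landed; nothing here is a claim about the Yang–Mills mass gap

CITATION HEADER.  T. Bałaban, *Regularity and decay of lattice Green's functions*, Commun. Math. Phys. **89** (1983)
571–597, doi:10.1007/bf01214744 [Balaban1983RegularityDecay] (cell paper B4; held text
`paper:balaban1983-cmp89-regularity-decay`, journal page = PDF page + 570; pp. 573, 575–579, 581).  Unit `lit-balaban-p17`
gen 5 (Phase-2 proof seat p17; HOME `run/shared/lean/pub/lit-balaban/`), SKELETON row **B4.Thm@573** (Theorem p. 573,
(1.10) value member, rectangular `Ω`; also B4.Eq2.2 / B4.Eq2.18 / B4.Lem2.2 as inputs).  Imports p17 g5 `B4Thm110BoxCut`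
(the walk route with the cut cubes, `thm110_value_boxCut_cubeField`) and p17 g4 `B4Thm110BoxRegular` (`const_inputs`,
`cubeField_eq_constBond_of_collar`, `greenA_congr_bonds`, `kOp_congr_bonds`; → p35 g6 `B4Eq220CubeField`:
`lemma22_sup_cubeField`, `eq220_cubeField`).

WHAT IS PRINTED.  p. 573: «Theorem. … there exist positive constants δ₀, c₀, R₀ independent of A, k, Ω and depending on
d, M only … such that for e sufficiently small … |(G_k(Ω, A)f)(x)| ≤ c₀ exp(−δ₀ dist(x, supp f)) ‖f‖_∞ (1.10) … For some
simple sets Ω, e.g. for rectangular parallelepipeds, the inequalities hold without any restrictions on the points x, x′»;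
p. 575 «□_j = Ω ∩ {…}», «A = A₀ + A′ … e.g. A₀ = A(Mj) … c′ = dMc»; p. 579 «if Ω is a rectangular parallelepiped, then all
□_j in the representation (2.13) are cubes and we can apply Lemma 2.2 to all operators in it»; p. 581 (Lemma 2.2's
hypothesis) «Only here we needed the assumption that A is constant in a neighbourhood of ∂□».

WHAT THIS MODULE PROVES (all in full; `Ω = Box d ℓ k Mb`, `n = (ℓ+1)^k`, `d ≥ 1`).
* §1 `IsInt Mb K j` (interior label: `1 ≤ j_μ ≤ Mb_μ/K − 1` ∀μ), `nonint_face` (a non-interior label of `labelsK` is a face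
  label in the sense of `B4Thm110BoxRegular.cubeField_eq_constBond_of_collar`), `baseVal` (the print's «A₀ = A(Mj)»
  realised PER CUBE: the value of `A` at the corner `n·cubeLo j` of an interior cube, `A(0)` at a face cube), `regular_shift`
  ((1.7) is translation invariant: the translated field is regular on the sub-box with the same constant).
* §2 `face_const` — at a face label, for `A` constant on the collar of width `K` at `∂Ω`, the cube configuration on the
  sub-box is the constant configuration `A(0)` on every nearest-neighbour bond of the sub-box.
* §3 **`thm110_value_box_uniform`** — THEOREM (1.10), value member, on a box, HYPOTHESIS-FREE: `∃ K` (`8 ≤ K`, `4 ∣ K`),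
  `∃ c₀ > 0`, `∀ (c, β)` `∃ e₁ > 0` — BEFORE the box — such that for every `k ≥ 1`, `(a, m²)` in the window, EVERY box
  `Ω = Π[0, nMb_μ)` with `K ∣ Mb_μ` (no size bound), every component field `A` (1.7)-regular on `Ω` with `0 < e ≤ e₁` and
  `A = A(0)` on the collar of width `K` at `∂Ω`, every fine site `x`, every `f` supported at sup-distance `≥ D` from `x`:
  `|(G_k(Ω,A)f)(x)_i| ≤ c₀·e^{−D/K}·‖f‖_∞`.  Compared with p17 g4's `B4Thm110BoxRegular.thm110_value_box_regular` the
  box-size bound `S` is GONE from the threshold: the per-cube inputs are taken on the cut cubes (sides `≤ 2K`) with the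
  print's per-cube base value `A₀ = A(corner of □_j)`, so p35's «c′ = dMc» is `(d+1)·2K·c`.
HONEST SCOPE.  (i) Value member (1.10) only (derivative, Hölder and `δG` members: sequels); (ii) `d ≥ 1`; (iii) the
lineage's (1.6) (abelian one-parameter orthogonal flow, component field, staircase contours, running coefficient
`a_kη^{d+1}`, charge `eη`); (iv) `A` constant on the collar of width `K` (= the print's `M`) at `∂Ω` — our reading of how
Lemma 2.2 («Ã constant in a neighbourhood of the boundary of □») is applied at the boundary cubes of a parallelepiped
(p. 579), recorded in HOME/GAPS.md G-B4-p17-02, not hidden; (v) `δ₀ = 1/K` per unit length, `c₀`, `K` depend on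
`(d, N, flow Lipschitz constant, L, a₋, a₊, m²₊)`, `e₁` on these and `(c, β)` ONLY.  One `def` with body (`baseVal`), one
decidable predicate (`IsInt`); no `Prop` fact, no `sorry`; axioms standard.
DOCFIX 2026-08-22 (lit-balaban-p17 gen 26, on r04 g22 `CITELOC-AUDIT-g22.md` §3, verified on the text layer of [Balaban1983RegularityDecay]): citation locators only — «(1.7) p.573» → «(1.7) p.572» at one `[cite:]` tag; every declaration byte-identical.
-/

namespace Literature.MathematicalPhysics.QuantumFieldTheory.Balaban1983to89.B4Thm110BoxUniform

open Literature.MathematicalPhysics.QuantumFieldTheory.Balaban1983to89.B4Reflection242 (boxDom mem_boxDom nbrs mem_nbrs blk)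
open Literature.MathematicalPhysics.QuantumFieldTheory.Balaban1983to89.B4GaugeCovariance
open Literature.MathematicalPhysics.QuantumFieldTheory.Balaban1983to89.B4Commutators25to211 (mulH opK)
open Literature.MathematicalPhysics.QuantumFieldTheory.Balaban1983to89.B4Lower18Regular (e1 baseEmb stairContour
  stairContour_end)
open Literature.MathematicalPhysics.QuantumFieldTheory.Balaban1983to89.B4Lower18RegularRegion (compField)
open Literature.MathematicalPhysics.QuantumFieldTheory.Balaban1983to89.B4Lemma22ReduceZero (Box opA greenA)
open Literature.MathematicalPhysics.QuantumFieldTheory.Balaban1983to89.B4Lemma22Reduce231 (supN supN_nonneg)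
open Literature.MathematicalPhysics.QuantumFieldTheory.Balaban1983to89.B4Eq220PartitionSizes (hBox)
open Literature.MathematicalPhysics.QuantumFieldTheory.Balaban1983to89.B4Eq220CommutatorField (kOp)
open Literature.MathematicalPhysics.QuantumFieldTheory.Balaban1983to89.B4CubeFields22 (cubeField cubeField_eq_compField)
open Literature.MathematicalPhysics.QuantumFieldTheory.Balaban1983to89.B4Eq220CubeField (eq220_cubeField
  lemma22_sup_cubeField)
open Literature.MathematicalPhysics.QuantumFieldTheory.Balaban1983to89.B4SubBoxCarrier (subEmb inSub subEmb_injective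
  mem_nbrs_add_iff)
open Literature.MathematicalPhysics.QuantumFieldTheory.Balaban1983to89.B4CubeGreenBox (subField)
open Literature.MathematicalPhysics.QuantumFieldTheory.Balaban1983to89.B4BoxCubeGeometry (posR cubeLo cubeMs cube_ho)
open Literature.MathematicalPhysics.QuantumFieldTheory.Balaban1983to89.B4RegionCubeCarrier (constBond_add)
open Literature.MathematicalPhysics.QuantumFieldTheory.Balaban1983to89.B4Thm110BoxRegular (const_inputs
  cubeField_eq_constBond_of_collar greenA_congr_bonds kOp_congr_bonds)
open Literature.MathematicalPhysics.QuantumFieldTheory.Balaban1983to89.B4Thm110BoxCut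
open scoped Matrix

noncomputable section

variable {d : ℕ}

/-! ## §1. Interior and face labels; the per-cube base value; regularity of the translated field -/

section Labels

variable (Mb : Fin (d + 1) → ℕ) (K : ℕ)

/-- **INTERIOR LABELS**: `1 ≤ j_μ ≤ Mb_μ/K − 1` in every direction — «if the point Mj is not a boundary point of Ω, then
□_j is a cube of the size 2M and with center in Mj» (p.575). [cite: Balaban1983RegularityDecay, §2 p.575] -/
def IsInt (j : Fin (d + 1) → ℤ) : Prop := ∀ μ, 1 ≤ j μ ∧ j μ + 1 ≤ ((Mb μ / K : ℕ) : ℤ)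

/-- interior-ness of a label is decidable (the per-cube base value branches on it).
[cite: Balaban1983RegularityDecay, §2 p.575, dictionary] -/
instance IsInt.decidable (j : Fin (d + 1) → ℤ) : Decidable (IsInt Mb K j) := by
  unfold IsInt; infer_instance

/-- **THE PER-CUBE BASE VALUE `A₀`** (p.575 «A₀ is a constant configuration, e.g. A₀ = A(Mj)»): at an interior cube the
value of the component field at the corner `n·cubeLo j` of `□_j` (a point of the cube — so that «|A′| ≤ c′e^{β−1},
c′ = dMc» holds with the CUBE size, not the size of `Ω`); at a face cube `A(0)` (there `Ã_j` is the constant configuration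
for a field constant on the collar, `B4Thm110BoxRegular.cubeField_eq_constBond_of_collar`).
[cite: Balaban1983RegularityDecay, §2 p.575 «A₀ = A(Mj)», «c′ = dMc»] -/
def baseVal (n : ℕ) (Ac : (Fin (d + 1) → ℤ) → Fin (d + 1) → ℝ) (j : Fin (d + 1) → ℤ) : Fin (d + 1) → ℝ :=
  if IsInt Mb K j then Ac ((0 : Fin (d + 1) → ℤ) + fun i => (n : ℤ) * (cubeLo Mb K j i : ℤ)) else Ac 0

variable {Mb K}

/-- the base value at an interior label. [cite: Balaban1983RegularityDecay, §2 p.575 «A₀ = A(Mj)»] -/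
theorem baseVal_of_isInt (n : ℕ) (Ac : (Fin (d + 1) → ℤ) → Fin (d + 1) → ℝ) {j : Fin (d + 1) → ℤ}
    (hj : IsInt Mb K j) : baseVal Mb K n Ac j = Ac ((0 : Fin (d + 1) → ℤ) + fun i => (n : ℤ) * (cubeLo Mb K j i : ℤ)) :=
  if_pos hj

/-- the base value at a face label. [cite: Balaban1983RegularityDecay, §2 p.575, p.581] -/
theorem baseVal_of_not_isInt (n : ℕ) (Ac : (Fin (d + 1) → ℤ) → Fin (d + 1) → ℝ) {j : Fin (d + 1) → ℤ}
    (hj : ¬ IsInt Mb K j) : baseVal Mb K n Ac j = Ac 0 :=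
  if_neg hj

/-- a non-interior label of `labelsK` is a FACE label: `j_μ ≤ 0` or `Mb_μ ≤ K j_μ` for some `μ` (the hypothesis of
`B4Thm110BoxRegular.cubeField_eq_constBond_of_collar`). [cite: Balaban1983RegularityDecay, §2 p.575 «For Mj lying on the
boundary the set □_j is a sum of several (≤ 2^d) large blocks»] -/
theorem nonint_face (hKM : ∀ μ, K ∣ Mb μ) {j : Fin (d + 1) → ℤ} (hj : j ∈ labelsK Mb K) (h : ¬ IsInt Mb K j) :
    ∃ μ, j μ ≤ 0 ∨ (Mb μ : ℤ) ≤ (K : ℤ) * j μ := by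
  obtain ⟨μ, hμ⟩ := not_forall.mp h
  refine ⟨μ, ?_⟩
  obtain ⟨hj0, hjm⟩ := (mem_labelsK_iff.1 hj) μ
  by_cases h1 : 1 ≤ j μ
  · right
    have h2 : ¬ j μ + 1 ≤ ((Mb μ / K : ℕ) : ℤ) := fun h2 => hμ ⟨h1, h2⟩
    have hjm' : j μ = ((Mb μ / K : ℕ) : ℤ) := by omega
    obtain ⟨t, ht⟩ := hKM μ
    rcases Nat.eq_zero_or_pos K with hK0 | hK0
    · subst hK0
      simp only [zero_mul] at ht
      simp [ht]
    · have htm : Mb μ / K = t := by rw [ht, Nat.mul_div_cancel_left _ hK0]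
      rw [hjm', htm, ht]; push_cast; exact le_rfl
  · left; omega

/-- **(1.7) IS TRANSLATION INVARIANT**: the translated component field `A^{(j)}_ν(y) = A_ν(y + n·cubeLo j)` is regular on
the sub-box `□_j` with the same bound. [cite: Balaban1983RegularityDecay, (1.7) p.572] -/
theorem regular_shift {ℓ k : ℕ} {Mb : Fin (d + 1) → ℕ} {K : ℕ} (j : Fin (d + 1) → ℤ)
    {Ac : (Fin (d + 1) → ℤ) → Fin (d + 1) → ℝ} {δ : ℝ}
    (h17 : ∀ x ∈ Box d ℓ k Mb, ∀ μ ν : Fin (d + 1), |Ac (x + e1 μ) ν - Ac x ν| ≤ δ) :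
    ∀ x ∈ Box d ℓ k (cubeMs Mb K j), ∀ μ ν : Fin (d + 1),
      |Ac (x + e1 μ + fun i => (((ℓ + 1) ^ k : ℕ) : ℤ) * (cubeLo Mb K j i : ℤ)) ν
        - Ac (x + fun i => (((ℓ + 1) ^ k : ℕ) : ℤ) * (cubeLo Mb K j i : ℤ)) ν| ≤ δ := by
  intro x hx μ ν
  have hmem : (x + fun i => (((ℓ + 1) ^ k : ℕ) : ℤ) * (cubeLo Mb K j i : ℤ)) ∈ Box d ℓ k Mb :=
    (subEmb ℓ k Mb (cubeMs Mb K j) (cubeLo Mb K j) (cube_ho Mb K j) ⟨x, hx⟩).2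
  have h := h17 _ hmem μ ν
  rwa [add_right_comm] at h

end Labels

/-! ## §2. At a face label the cube configuration on the sub-box is the constant configuration -/

section Face

/-- **AT A FACE LABEL, FOR `A = A(0)` ON THE COLLAR OF WIDTH `K` AT `∂Ω`, THE CUBE CONFIGURATION `Ã_{jloc j}` OF THE
TRANSLATED FIELD ON THE SUB-BOX `□_j` IS THE CONSTANT CONFIGURATION `A(0)`** on every nearest-neighbour bond of the
sub-box (p.581 «Only here we needed the assumption that A is constant in a neighbourhood of ∂□»; p17 g4's
`cubeField_eq_constBond_of_collar` on `Ω`, transported along `subEmb` by `B4Thm110BoxCut.subField_cubeField`).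
[cite: Balaban1983RegularityDecay, p.581; §2 p.575 (Ã_j)] -/
theorem face_const {ℓ k : ℕ} {Mb : Fin (d + 1) → ℕ} {K : ℕ} (hK : 1 ≤ K) (hKM : ∀ μ, K ∣ Mb μ)
    (Ac : (Fin (d + 1) → ℤ) → Fin (d + 1) → ℝ) {j : Fin (d + 1) → ℤ} (hj : j ∈ labelsK Mb K) (hface : ¬ IsInt Mb K j)
    (hcol : ∀ w : ↥(Box d ℓ k Mb), (∃ μ, w.1 μ < (((ℓ + 1) ^ k : ℕ) : ℤ) * K ∨
      (((ℓ + 1) ^ k : ℕ) : ℤ) * Mb μ < w.1 μ + (((ℓ + 1) ^ k : ℕ) : ℤ) * K) → ∀ ν, Ac w.1 ν = Ac 0 ν)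
    (u v : ↥(Box d ℓ k (cubeMs Mb K j))) (huv : v.1 ∈ nbrs u.1) :
    cubeField (Box d ℓ k (cubeMs Mb K j)) ((ℓ + 1) ^ k) K (jloc j) (Ac 0)
        (fun y => Ac (y + fun i => (((ℓ + 1) ^ k : ℕ) : ℤ) * (cubeLo Mb K j i : ℤ))) u v
      = constBond (Ac 0) Subtype.val u v := by
  have hn : 1 ≤ (ℓ + 1) ^ k := Nat.one_le_pow _ _ (Nat.succ_pos ℓ)
  set e := subEmb ℓ k Mb (cubeMs Mb K j) (cubeLo Mb K j) (cube_ho Mb K j) with he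
  have hea : ∀ c : ↥(Box d ℓ k (cubeMs Mb K j)),
      (e c).1 = c.1 + fun i => (((ℓ + 1) ^ k : ℕ) : ℤ) * (cubeLo Mb K j i : ℤ) := fun c => rfl
  -- the restriction identity, pointwise
  have h1 := congrFun (congrFun (subField_cubeField (ℓ := ℓ) (k := k) hK hKM hj (Ac 0) Ac) u) v
  rw [← h1]
  -- on `Ω` the cube configuration is the constant one on the (nearest-neighbour) image bond
  have hnb : (e v).1 ∈ nbrs (e u).1 := by
    rw [hea u, hea v]; exact (mem_nbrs_add_iff _ _ _).2 huv
  have h2 := cubeField_eq_constBond_of_collar hn hK Ac (nonint_face hKM hj hface) hcol (e u) (e v) hnb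
  have h3 : constBond (Ac 0) Subtype.val (e u) (e v) = constBond (Ac 0) Subtype.val u v :=
    constBond_add (Ac 0) Subtype.val Subtype.val (fun i => (((ℓ + 1) ^ k : ℕ) : ℤ) * (cubeLo Mb K j i : ℤ)) e hea u v
  show cubeField (Box d ℓ k Mb) ((ℓ + 1) ^ k) K j (Ac 0) Ac (e u) (e v) = _
  rw [h2, h3]

end Face

/-! ## §3. THEOREM (1.10), value member, on a box — hypothesis-free, «e sufficiently small» uniform in `Ω` -/

section Main

variable {ι : Type} [Fintype ι] [DecidableEq ι]

/-- **THEOREM (1.10) OF [B4] ON A BOX, VALUE MEMBER — FOR A (1.7)-REGULAR FIELD CONSTANT NEAR `∂Ω`, WITH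
«e SUFFICIENTLY SMALL» UNIFORM IN `Ω` AND THE LARGE-CUBE SIZE CHOSEN** (pp.573–579, p.581; the print's cut cubes):
there are `K` (`8 ≤ K`, `4 ∣ K`) and `c₀ > 0` (depending on the structure group data, `d`, `L`, the window) such that for all
`c ≥ 0`, `β > 0` there is `e₁ > 0` with — for every `k ≥ 1`, `(a,m²) ∈ [a₋,a₊]×[0,m²₊]`, EVERY box `Ω = Π[0, nMb_μ)` with
`K ∣ Mb_μ`, `1 ≤ Mb_μ` (no size bound), component field `A` with `|A_ν(x+e_μ) − A_ν(x)| ≤ c·e^{β−1}η` on `Ω` ((1.7)),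
`0 < e ≤ e₁`, `A = A(0)` on the collar of width `K` at `∂Ω`, every fine site `x`, every set `P` with `|x/n − x′/n|_∞ ≥ D`
on `P`, every source `f` supported in `P` with `|f| ≤ φ` — `|(G_k(Ω,A)f)(x)_i| ≤ c₀·e^{−D/K}·φ` (`δ₀ = 1/K` per unit
length; constants «independent of A, k, Ω»). [cite: Balaban1983RegularityDecay, Theorem (1.10) p.573; pp.575–579, p.581] -/
theorem thm110_value_box_uniform (F : OrthFlow ι) {ℓ₁ : ℝ} (hℓ₁ : 0 ≤ ℓ₁)
    (hLip : ∀ t (v : ι → ℝ), ((F.U t - 1) *ᵥ v) ⬝ᵥ ((F.U t - 1) *ᵥ v) ≤ (ℓ₁ * t) ^ 2 * (v ⬝ᵥ v))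
    (d ℓ : ℕ) (hd : 1 ≤ d) (hℓ : 1 ≤ ℓ) (amin aplus m2plus : ℝ) (ha : 0 < amin) :
    ∃ K : ℕ, 8 ≤ K ∧ 4 ∣ K ∧ ∃ c₀ : ℝ, 0 < c₀ ∧ ∀ (creg β : ℝ), 0 ≤ creg → 0 < β →
      ∃ e₁ : ℝ, 0 < e₁ ∧ ∀ (k : ℕ), 1 ≤ k → ∀ (hn : 1 ≤ (ℓ + 1) ^ k) (a m2 : ℝ),
      amin ≤ a → a ≤ aplus → 0 ≤ m2 → m2 ≤ m2plus →
      ∀ (Mb : Fin (d + 1) → ℕ), (∀ i, 1 ≤ Mb i) → (∀ μ, K ∣ Mb μ) →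
      ∀ (Ac : (Fin (d + 1) → ℤ) → Fin (d + 1) → ℝ) (e : ℝ), 0 < e → e ≤ e₁ →
        (∀ x ∈ Box d ℓ k Mb, ∀ μ ν : Fin (d + 1),
          |Ac (x + e1 μ) ν - Ac x ν| ≤ creg * e ^ (β - 1) / ((ℓ + 1) ^ k : ℕ)) →
        (∀ w ∈ Box d ℓ k Mb, (∃ μ, w μ < (((ℓ + 1) ^ k : ℕ) : ℤ) * K ∨
            (((ℓ + 1) ^ k : ℕ) : ℤ) * Mb μ < w μ + (((ℓ + 1) ^ k : ℕ) : ℤ) * K) → ∀ ν, Ac w ν = Ac 0 ν) →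
      ∀ (x : ↥(Box d ℓ k Mb)) (P : ↥(Box d ℓ k Mb) → Prop) [DecidablePred P] (D : ℝ),
        (∀ x', P x' → ∃ μ, D ≤ |posR ℓ k Mb x μ - posR ℓ k Mb x' μ|) →
      ∀ (f : ↥(Box d ℓ k Mb) × ι → ℝ), (∀ p, ¬ P p.1 → f p = 0) → ∀ (φ : ℝ), 0 ≤ φ → (∀ p, |f p| ≤ φ) →
      ∀ i : ι,
        |(greenA d F (e / ((ℓ + 1) ^ k : ℕ)) ℓ k a m2 Mb (baseEmb hn Mb) (stairContour hn Mb)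
            (fun u v : ↥(Box d ℓ k Mb) => compField Ac u.1 v.1) *ᵥ f) (x, i)|
          ≤ c₀ * Real.exp (-(D / K)) * φ := by
  obtain ⟨C₁, hC₁, h₁⟩ := lemma22_sup_cubeField F hℓ₁ hLip d ℓ hℓ amin aplus m2plus ha
  obtain ⟨C₂, hC₂, h₂⟩ := eq220_cubeField F hℓ₁ hLip d ℓ hℓ amin aplus m2plus ha
  obtain ⟨cG₀, cK₀, hcG₀, hcK₀, h₀⟩ := const_inputs F hℓ₁ hLip d ℓ hℓ amin aplus m2plus ha
  set X : ℝ := (3 : ℝ) ^ (d + 1) * Real.sqrt (Fintype.card ι) * (C₂ + cK₀) * Real.exp 1 with hX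
  have hX0 : 0 ≤ X := by positivity
  set K : ℕ := 8 * (⌈X⌉₊ + 1) with hK
  have hK8 : 8 ≤ K := by omega
  have h4 : 4 ∣ K := ⟨2 * (⌈X⌉₊ + 1), by omega⟩
  have hK2 : 2 ≤ K := by omega
  have hK1 : 1 ≤ K := by omega
  have hKr : (0 : ℝ) < K := by exact_mod_cast hK1
  have hKX : X ≤ K := by
    refine (Nat.le_ceil X).trans ?_
    rw [hK]
    push_cast
    linarith [(Nat.cast_nonneg ⌈X⌉₊ : (0 : ℝ) ≤ ⌈X⌉₊)]
  set cG : ℝ := max C₁ cG₀ with hcG_def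
  set cK : ℝ := (C₂ + cK₀) / K with hcK_def
  have hcG : 0 ≤ cG := hC₁.le.trans (le_max_left _ _)
  have hcK : 0 ≤ cK := div_nonneg (by positivity) hKr.le
  have h3 : (3 : ℝ) ^ (d + 1) * (Real.sqrt (Fintype.card ι) * cK) ≤ Real.exp (-1) := by
    have hexp : Real.exp 1 * Real.exp (-1) = 1 := by rw [← Real.exp_add]; norm_num
    have e : (3 : ℝ) ^ (d + 1) * (Real.sqrt (Fintype.card ι) * cK) = X / K * Real.exp (-1) := by
      rw [hcK_def, hX]
      calc (3 : ℝ) ^ (d + 1) * (Real.sqrt (Fintype.card ι) * ((C₂ + cK₀) / K))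
          = (3 : ℝ) ^ (d + 1) * Real.sqrt (Fintype.card ι) * (C₂ + cK₀) / K * (Real.exp 1 * Real.exp (-1)) := by
            rw [hexp]; ring
        _ = (3 : ℝ) ^ (d + 1) * Real.sqrt (Fintype.card ι) * (C₂ + cK₀) * Real.exp 1 / K * Real.exp (-1) := by
            ring
    rw [e]
    have : X / K ≤ 1 := div_le_one_of_le₀ hKX (Nat.cast_nonneg K)
    calc X / K * Real.exp (-1) ≤ 1 * Real.exp (-1) := mul_le_mul_of_nonneg_right this (Real.exp_pos _).le
      _ = Real.exp (-1) := one_mul _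
  set c₀ : ℝ := 2 ^ (d + 2) * Real.exp (9 / 4) * max (Real.sqrt (Fintype.card ι) * cG) 2 + 1 with hc₀
  refine ⟨K, hK8, h4, c₀, by positivity, fun creg β hcreg hβ => ?_⟩
  -- the thresholds at the box-size bound `2K` of the CUT cubes — uniform in `Ω`
  obtain ⟨e₁, he₁, h₁'⟩ := h₁ creg β hcreg hβ (2 * K) K hK1
  obtain ⟨e₂, he₂, h₂'⟩ := h₂ creg β hcreg hβ (2 * K) K hK2
  refine ⟨min e₁ e₂, lt_min he₁ he₂, ?_⟩
  intro k hk hn a m2 ea1 ea2 em1 em2 Mb hM hKM Ac e he hle h17 hcol x P _ D hD f hfP φ hφ hf i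
  have hn2 : 2 ≤ (ℓ + 1) ^ k := by
    calc 2 ≤ ℓ + 1 := by omega
      _ = (ℓ + 1) ^ 1 := (pow_one _).symm
      _ ≤ (ℓ + 1) ^ k := Nat.pow_le_pow_right (Nat.succ_pos ℓ) hk
  have hnK : 16 ≤ (ℓ + 1) ^ k * K := by nlinarith
  have ha' : 0 < a := lt_of_lt_of_le ha ea1
  have hcol' : ∀ w : ↥(Box d ℓ k Mb), (∃ μ, w.1 μ < (((ℓ + 1) ^ k : ℕ) : ℤ) * K ∨
      (((ℓ + 1) ^ k : ℕ) : ℤ) * Mb μ < w.1 μ + (((ℓ + 1) ^ k : ℕ) : ℤ) * K) → ∀ ν, Ac w.1 ν = Ac 0 ν :=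
    fun w hw => hcol w.1 w.2 hw
  -- abbreviations: the translated field of the cube `j` and its cube configuration on the sub-box
  set AcS : (Fin (d + 1) → ℤ) → (Fin (d + 1) → ℤ) → Fin (d + 1) → ℝ :=
    fun j y => Ac (y + fun i => (((ℓ + 1) ^ k : ℕ) : ℤ) * (cubeLo Mb K j i : ℤ)) with hAcS
  have hregS : ∀ j, ∀ y ∈ Box d ℓ k (cubeMs Mb K j), ∀ μ ν : Fin (d + 1),
      |AcS j (y + e1 μ) ν - AcS j y ν| ≤ creg * e ^ (β - 1) / ((ℓ + 1) ^ k : ℕ) :=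
    fun j => regular_shift (Mb := Mb) (K := K) j h17
  have hbase : ∀ j, IsInt Mb K j → baseVal Mb K ((ℓ + 1) ^ k) Ac j = AcS j 0 := fun j hj => by
    rw [baseVal_of_isInt _ _ hj]
  -- the sub-box data at every label
  have hMs1 : ∀ j ∈ labelsK Mb K, ∀ μ, 1 ≤ cubeMs Mb K j μ := fun j hj μ => one_le_cubeMs hK1 hKM hM hj μ
  have hMsS : ∀ j ∈ labelsK Mb K, ∀ μ, cubeMs Mb K j μ ≤ 2 * K := fun j hj μ => cubeMs_le hK1 hKM hM hj μ
  have hMsK : ∀ j ∈ labelsK Mb K, ∀ μ, K ∣ cubeMs Mb K j μ := fun j hj μ => dvd_cubeMs hK1 hKM hM hj μ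
  -- the per-cube inputs
  have hG : ∀ j ∈ labelsK Mb K, ∀ Φ : ↥(Box d ℓ k (cubeMs Mb K j)) × ι → ℝ,
      supN (greenA d F (e / ((ℓ + 1) ^ k : ℕ)) ℓ k a m2 (cubeMs Mb K j) (baseEmb hn _) (stairContour hn _)
          (cubeField (Box d ℓ k (cubeMs Mb K j)) ((ℓ + 1) ^ k) K (jloc j) (baseVal Mb K ((ℓ + 1) ^ k) Ac j)
            (AcS j)) *ᵥ Φ) ≤ cG * supN Φ := by
    intro j hj Φ
    by_cases hint : IsInt Mb K j
    · have hin := fun μ => cubeMs_interior hK1 hKM hM hj hint μ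
      rw [hbase j hint]
      have hb := (h₁' k hk hn hnK a m2 ea1 ea2 em1 em2 (cubeMs Mb K j) (hMs1 j hj) (hMsS j hj) (jloc j)
        (fun μ => by rw [(hin μ).2]) (fun μ => by rw [(hin μ).1, (hin μ).2]; push_cast; omega)
        (AcS j) e he (hle.trans (min_le_left _ _)) (hregS j) Φ).1
      exact hb.trans (mul_le_mul_of_nonneg_right (le_max_left _ _) (supN_nonneg Φ))
    · rw [baseVal_of_not_isInt _ _ hint,
        greenA_congr_bonds F _ hn a m2 (cubeMs Mb K j) (face_const hK1 hKM Ac hj hint hcol')]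
      exact ((h₀ k hk hn a m2 ea1 ea2 em1 em2 (cubeMs Mb K j) (hMs1 j hj) K (jloc j) hK2 (hMsK j hj) _ (Ac 0)).1 Φ).trans
        (mul_le_mul_of_nonneg_right (le_max_right _ _) (supN_nonneg Φ))
  have hKG : ∀ j ∈ labelsK Mb K, ∀ Φ : ↥(Box d ℓ k (cubeMs Mb K j)) × ι → ℝ,
      supN (kOp F (e / ((ℓ + 1) ^ k : ℕ)) ((ℓ + 1) ^ k) (B1.aSeq a ((ℓ : ℝ) + 1) k) m2 (cubeMs Mb K j)
            (baseEmb hn _) (stairContour hn _)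
            (cubeField (Box d ℓ k (cubeMs Mb K j)) ((ℓ + 1) ^ k) K (jloc j) (baseVal Mb K ((ℓ + 1) ^ k) Ac j) (AcS j))
            (hBox ((ℓ + 1) ^ k) K (cubeMs Mb K j) (jloc j))
          *ᵥ (greenA d F (e / ((ℓ + 1) ^ k : ℕ)) ℓ k a m2 (cubeMs Mb K j) (baseEmb hn _) (stairContour hn _)
              (cubeField (Box d ℓ k (cubeMs Mb K j)) ((ℓ + 1) ^ k) K (jloc j) (baseVal Mb K ((ℓ + 1) ^ k) Ac j)
                (AcS j))
            *ᵥ (mulH (ι := ι) (hBox ((ℓ + 1) ^ k) K (cubeMs Mb K j) (jloc j)) *ᵥ Φ))) ≤ cK * supN Φ := by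
    intro j hj Φ
    have hsplit : ∀ t : ℝ, 0 ≤ t → t ≤ C₂ + cK₀ → t / K * supN Φ ≤ cK * supN Φ := fun t _ ht =>
      mul_le_mul_of_nonneg_right (div_le_div_of_nonneg_right ht hKr.le) (supN_nonneg Φ)
    by_cases hint : IsInt Mb K j
    · have hin := fun μ => cubeMs_interior hK1 hKM hM hj hint μ
      rw [hbase j hint]
      have hb := h₂' k hk hn hnK a m2 ea1 ea2 em1 em2 (cubeMs Mb K j) (hMs1 j hj) (hMsS j hj) (hMsK j hj) (jloc j)
        (fun μ => by rw [(hin μ).2]) (fun μ => by rw [(hin μ).1, (hin μ).2]; push_cast; omega)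
        (AcS j) e he (hle.trans (min_le_right _ _)) (hregS j) Φ
      exact hb.trans (hsplit C₂ hC₂.le (by linarith))
    · have hb := face_const (ℓ := ℓ) (k := k) hK1 hKM Ac hj hint hcol'
      rw [baseVal_of_not_isInt _ _ hint, kOp_congr_bonds F _ hn a m2 (cubeMs Mb K j) hb,
        greenA_congr_bonds F _ hn a m2 (cubeMs Mb K j) hb]
      exact ((h₀ k hk hn a m2 ea1 ea2 em1 em2 (cubeMs Mb K j) (hMs1 j hj) K (jloc j) hK2 (hMsK j hj) _ (Ac 0)).2 Φ).trans
        (hsplit cK₀ hcK₀.le (by linarith))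
  have main := thm110_value_boxCut_cubeField F hℓ hk hn hd Mb hM hK8 h4 hKM ha' em1 e Ac
    (baseVal Mb K ((ℓ + 1) ^ k) Ac) hcG hcK hG hKG h3 x P hD f hfP hφ hf i
  refine main.trans (mul_le_mul_of_nonneg_right (mul_le_mul_of_nonneg_right ?_ (Real.exp_pos _).le) hφ)
  rw [hc₀]
  linarith

end Main

end

end Literature.MathematicalPhysics.QuantumFieldTheory.Balaban1983to89.B4Thm110BoxUniform
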